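import Summits.Parity.GeneralizedHardyLittlewood.Theorems.PrimeLevelFamEdgeMomentsBeyondDiagonalDiagLineSum
import HarnessLib

/-!
# Route `PrimeLevelFamEdge`, crux K_A `MomentsBeyondDiagonal` (stmt-Parity-20007), line «petersson_layers» v4, stub `stub_diag`:
# THE BOSE INNER INTEGRAL — domination and binomial expansion in the log shift (census R2, first bricks)

The main term of `stub_diag` lives in the Bose double integral of `…DiagLineSum`,
`𝔚_{ij}(A₁,A₂;y) = ∫_{u₁>0}(A₁+log u₁)^i ∫_{u₂>y/u₁} e^{−φ}(1−e^{−φ})^{−2}(A₂+log u₂)^j du₂ du₁` (`φ = u₁+u₂`, `y > 0`). Census R2 asks for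
its structure as a polynomial in `(A₁, A₂)` with coefficients `c_{ab}(y)`. This file gives the pointwise-in-`u₁` bricks:

* `bose_kernel_le` — on the region `u₁u₂ > y` one has `φ ≥ √y`, so `e^{−φ}(1−e^{−φ})^{−2} ≤ (1−e^{−√y})^{−2} e^{−u₁} e^{−u₂}`:
  the Bose kernel is dominated by a PRODUCT of integrable weights (uniformly in the line data);
* `integrableOn_bose_logPow` — `u₂ ↦ e^{−φ}(1−e^{−φ})^{−2}(log u₂)^b` is integrable on `u₂ > y/u₁` (`u₁ > 0`);
* `bose_inner_expand` — **`∫_{u₂>y/u₁} e^{−φ}(1−e^{−φ})^{−2}(A₂+log u₂)^j du₂ = Σ_{b≤j} C(j,b) A₂^{j−b} ∫_{u₂>y/u₁} e^{−φ}(1−e^{−φ})^{−2}(log u₂)^b du₂`.**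

The outer expansion (in `A₁`) needs the measurability of these parametric integrals in `u₁` (pattern: `continuousAt_expTail` of
`…DiagLineSum`) and is left to R2 proper. Helper `--supports stmt-Parity-20007`; closes nothing; K_A, K_B and the Parity summit are NOT
proved; nothing about Landau–Siegel zeros.
-/

noncomputable section

open Real Set MeasureTheory Filter Finset
open Literature.NumberTheory.LFunctions

namespace Summit.Parity.GeneralizedHardyLittlewood.Theorems.MomentsBeyondDiagonal.DiagLines

/-- **Domination of the Bose kernel on the line region.** For `y > 0`, `u₁ > 0`, `u₂ > y/u₁` (so `φ = u₁+u₂ ≥ √y`):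
`e^{−φ}/(1−e^{−φ})² ≤ (1 − e^{−√y})^{−2} · e^{−u₁} · e^{−u₂}`. [folklore] -/
theorem bose_kernel_le {y u₁ u₂ : ℝ} (hy : 0 < y) (hu₁ : 0 < u₁) (hu₂ : y / u₁ < u₂) :
    Real.exp (-(u₁ + u₂)) / (1 - Real.exp (-(u₁ + u₂))) ^ 2 ≤
      ((1 - Real.exp (-Real.sqrt y)) ^ 2)⁻¹ * (Real.exp (-u₁) * Real.exp (-u₂)) := by
  have hsq : Real.sqrt y ≤ u₁ + u₂ := by
    have h := KMV2000.sqrt_le_half_add_div hy.le hu₁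
    have : y / u₁ ≤ u₂ := hu₂.le
    linarith
  have hs0 : 0 < Real.sqrt y := Real.sqrt_pos.mpr hy
  have h1 : Real.exp (-(u₁ + u₂)) ≤ Real.exp (-Real.sqrt y) := Real.exp_le_exp.mpr (by linarith)
  have h2 : Real.exp (-Real.sqrt y) < 1 := Real.exp_lt_one_iff.mpr (by linarith)
  have hden : (1 - Real.exp (-Real.sqrt y)) ^ 2 ≤ (1 - Real.exp (-(u₁ + u₂))) ^ 2 := by
    apply pow_le_pow_left₀ (by linarith) (by linarith)
  have hd0 : 0 < (1 - Real.exp (-Real.sqrt y)) ^ 2 := pow_pos (by linarith) 2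
  rw [div_eq_mul_inv]
  calc Real.exp (-(u₁ + u₂)) * ((1 - Real.exp (-(u₁ + u₂))) ^ 2)⁻¹
      ≤ Real.exp (-(u₁ + u₂)) * ((1 - Real.exp (-Real.sqrt y)) ^ 2)⁻¹ :=
        mul_le_mul_of_nonneg_left (inv_anti₀ hd0 hden) (Real.exp_pos _).le
    _ = ((1 - Real.exp (-Real.sqrt y)) ^ 2)⁻¹ * (Real.exp (-u₁) * Real.exp (-u₂)) := by
        rw [neg_add, Real.exp_add]; ring

/-- **Integrability of the Bose inner integrand with a log power**: for `y > 0`, `u₁ > 0` and `b : ℕ`,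
`u₂ ↦ e^{−(u₁+u₂)}(1−e^{−(u₁+u₂)})^{−2}(A + log u₂)^b` is integrable on `u₂ > y/u₁`. [folklore] -/
theorem integrableOn_bose_logPow {y u₁ : ℝ} (hy : 0 < y) (hu₁ : 0 < u₁) (A : ℝ) (b : ℕ) :
    IntegrableOn (fun u₂ : ℝ ↦ Real.exp (-(u₁ + u₂)) / (1 - Real.exp (-(u₁ + u₂))) ^ 2 * (A + Real.log u₂) ^ b)
      (Ioi (y / u₁)) := by
  have hz : 0 < y / u₁ := div_pos hy hu₁
  set K : ℝ := ((1 - Real.exp (-Real.sqrt y)) ^ 2)⁻¹ * Real.exp (-u₁) with hK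
  have hmaj : IntegrableOn (fun u₂ : ℝ ↦ K * (Real.exp (-u₂) * |A + Real.log u₂| ^ b)) (Ioi (y / u₁)) :=
    ((integrableOn_exp_neg_mul_abs_logPow A b).mono_set (Ioi_subset_Ioi hz.le)).const_mul K
  have hcont : ContinuousOn
      (fun u₂ : ℝ ↦ Real.exp (-(u₁ + u₂)) / (1 - Real.exp (-(u₁ + u₂))) ^ 2 * (A + Real.log u₂) ^ b) (Ioi (y / u₁)) := by
    refine ContinuousOn.mul (ContinuousOn.div (by fun_prop) (by fun_prop) fun u₂ hu₂ ↦ ?_)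
      (ContinuousOn.pow (continuousOn_const.add (Real.continuousOn_log.mono fun x hx ↦ ne_of_gt (hz.trans hx))) b)
    have hu₂ : y / u₁ < u₂ := hu₂
    have hφ : 0 < u₁ + u₂ := by linarith [hz.le]
    have : Real.exp (-(u₁ + u₂)) < 1 := Real.exp_lt_one_iff.mpr (by linarith)
    exact pow_ne_zero 2 (by linarith)
  refine Integrable.mono' hmaj (hcont.aestronglyMeasurable measurableSet_Ioi) ?_
  rw [ae_restrict_iff' measurableSet_Ioi]
  refine ae_of_all _ fun u₂ (hu₂ : y / u₁ < u₂) ↦ ?_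
  have hB := bose_kernel_le hy hu₁ hu₂
  have hB0 : 0 ≤ Real.exp (-(u₁ + u₂)) / (1 - Real.exp (-(u₁ + u₂))) ^ 2 := div_nonneg (Real.exp_pos _).le (sq_nonneg _)
  rw [norm_mul, Real.norm_of_nonneg hB0, norm_pow, Real.norm_eq_abs]
  calc Real.exp (-(u₁ + u₂)) / (1 - Real.exp (-(u₁ + u₂))) ^ 2 * |A + Real.log u₂| ^ b
      ≤ ((1 - Real.exp (-Real.sqrt y)) ^ 2)⁻¹ * (Real.exp (-u₁) * Real.exp (-u₂)) * |A + Real.log u₂| ^ b := by gcongr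
    _ = K * (Real.exp (-u₂) * |A + Real.log u₂| ^ b) := by rw [hK]; ring

/-- **Binomial expansion of the Bose inner integral in the log shift** (`y > 0`, `u₁ > 0`):
`∫_{u₂>y/u₁} e^{−φ}(1−e^{−φ})^{−2}(A₂+log u₂)^j = Σ_{b ≤ j} C(j,b) A₂^{j−b} ∫_{u₂>y/u₁} e^{−φ}(1−e^{−φ})^{−2}(log u₂)^b` (`φ = u₁+u₂`).
[cite: KowalskiMichelVanderKam2000, (21)–(23) p. 12–13 — derivation] -/
theorem bose_inner_expand {y u₁ : ℝ} (hy : 0 < y) (hu₁ : 0 < u₁) (A₂ : ℝ) (j : ℕ) :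
    ∫ u₂ in Ioi (y / u₁), Real.exp (-(u₁ + u₂)) / (1 - Real.exp (-(u₁ + u₂))) ^ 2 * (A₂ + Real.log u₂) ^ j =
      ∑ b ∈ Finset.range (j + 1), (j.choose b : ℝ) * A₂ ^ (j - b) *
        ∫ u₂ in Ioi (y / u₁), Real.exp (-(u₁ + u₂)) / (1 - Real.exp (-(u₁ + u₂))) ^ 2 * Real.log u₂ ^ b := by
  have hint : ∀ b : ℕ, IntegrableOn
      (fun u₂ : ℝ ↦ Real.exp (-(u₁ + u₂)) / (1 - Real.exp (-(u₁ + u₂))) ^ 2 * Real.log u₂ ^ b) (Ioi (y / u₁)) := by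
    intro b
    have h := integrableOn_bose_logPow hy hu₁ 0 b
    simpa only [zero_add] using h
  have hexp : ∀ u₂ : ℝ, Real.exp (-(u₁ + u₂)) / (1 - Real.exp (-(u₁ + u₂))) ^ 2 * (A₂ + Real.log u₂) ^ j =
      ∑ b ∈ Finset.range (j + 1), (j.choose b : ℝ) * A₂ ^ (j - b) *
        (Real.exp (-(u₁ + u₂)) / (1 - Real.exp (-(u₁ + u₂))) ^ 2 * Real.log u₂ ^ b) := by
    intro u₂
    rw [add_comm A₂, add_pow, Finset.mul_sum]
    refine Finset.sum_congr rfl fun b _ ↦ ?_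
    ring
  simp_rw [hexp]
  rw [integral_finsetSum _ fun b _ ↦ (hint b).const_mul _]
  refine Finset.sum_congr rfl fun b _ ↦ ?_
  exact integral_const_mul _ _

end Summit.Parity.GeneralizedHardyLittlewood.Theorems.MomentsBeyondDiagonal.DiagLines

end
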